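import Mathlib
import Summits.Ventures.PercRepro2.CoinChainXASignsY
import Summits.Ventures.PercRepro2.CoinChainXANegSigns
import Summits.Ventures.PercRepro2.CoinChainReductionGen
import Summits.Ventures.PercRepro2.CoinChainHeadHyps

/-!
# Row 2′DARC at the GENERAL AND-switch chain under the three sign conditions
(blind cell PercRepro2, night-2 g26; proofs/NIGHT2-DARC.md §67)

`darc_of_chain_of_signs` (and its `y`-mirror `darc_of_chain_of_signs_y`, and
`darc_of_chain_of_negative_signs` for the all-nonpositive regime): the general chain (`a` entered from `ent ⊆ U` surely and from `a'` by
the coin, `a'` entered from `ent'` surely; chain data `ν = P(level)`, `c = chainC`, `d = chainD`,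
`d' = chainD'`; point markers `m₁, m₂ ∈ U`; an lsm core; positive world masses and ideal mass)
satisfies `DARC pr arcs s {t} m₁ m₂ a w` whenever, on the chain data, the coin and the world-0
gate lower the `m₁`-mean and the `D′`-pivotal `m₁`-shift is nonnegative (`hQx`, `hP0x`, `hP'x`
of `chain_XA'_of_signs`) — `chain_darc_of_functional` with `chain_functional_nonneg_of_signs`.
-/

namespace Summit.Ventures.PercRepro2.Coin

open Classical

section XASignsDarc

variable {V : Type*} {E : Type*} [Fintype V] [DecidableEq V] [Fintype E] [DecidableEq E]
  {R : Type*} [Field R] [LinearOrder R] [IsStrictOrderedRing R]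
  {arcs : E → Finset (V × V)} {s : V} {U : Finset V} {ent ent' : Finset V} {c' c : V → E}
  {a' a w : V}

/-- **ROW 2′DARC AT THE GENERAL AND-SWITCH CHAIN UNDER THE THREE SIGN CONDITIONS** (chain data
`ν = P(level)`, `c = chainC`, `d = chainD`, `d' = chainD'`, point markers `m₁, m₂ ∈ U`, an lsm
core, positive world masses and ideal mass): `DARC pr arcs s {t} m₁ m₂ a w`. -/
theorem darc_of_chain_of_signs (pr : E → R) (hp : IsProbVec pr) (hS : SameEnds arcs)
    (h' : OrTailK arcs s U ent' c' a') (hsure' : ∀ r ∈ ent', pr (c' r) = 1)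
    (h : OrTailK arcs s (insert a' U) (insert a' ent) c a) (hsure : ∀ r ∈ ent, pr (c r) = 1)
    (hentU : ent ⊆ U)
    {m₁ m₂ : V} (hm₁ : m₁ ∈ U) (hm₂ : m₂ ∈ U)
    (hν : ∀ W W', W ⊆ U → W' ⊆ U →
      prob pr (coreLevel arcs s U W) * prob pr (coreLevel arcs s U W') ≤
        prob pr (coreLevel arcs s U (W ∩ W')) * prob pr (coreLevel arcs s U (W ∪ W')))
    {t : V} (htC : t ∉ insert a (insert a' U)) (hts : t ≠ s) (hws : w ≠ s)
    (hwC : w ∉ insert a (insert a' U))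
    (hpos0 : 0 < ∑ W ∈ U.powerset, prob pr (coreLevel arcs s U W) *
      chainMix ent ent' 0 (chainC pr arcs s t U ent' a' a) (chainD pr arcs s t U ent' a' a) W)
    (hpos1 : 0 < ∑ W ∈ U.powerset, prob pr (coreLevel arcs s U W) *
      chainMix ent ent' 1 (chainC pr arcs s t U ent' a' a) (chainD pr arcs s t U ent' a' a) W)
    (hmI : 0 < ∑ W ∈ U.powerset.filter (fun W => ¬ ∃ r ∈ ent ∪ ent', r ∈ W),
      prob pr (coreLevel arcs s U W) * chainC pr arcs s t U ent' a' a W)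
    (hQx : (∑ W ∈ U.powerset, prob pr (coreLevel arcs s U W) * chainMix ent ent' 0 (chainC pr arcs s t U ent' a' a) (chainD pr arcs s t U ent' a' a) W) *
        (∑ W ∈ U.powerset, prob pr (coreLevel arcs s U W) * chainMix ent ent' 1 (chainC pr arcs s t U ent' a' a) (chainD pr arcs s t U ent' a' a) W * (if m₁ ∈ W then (1 : R) else 0)) ≤
      (∑ W ∈ U.powerset, prob pr (coreLevel arcs s U W) * chainMix ent ent' 0 (chainC pr arcs s t U ent' a' a) (chainD pr arcs s t U ent' a' a) W * (if m₁ ∈ W then (1 : R) else 0)) *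
        (∑ W ∈ U.powerset, prob pr (coreLevel arcs s U W) * chainMix ent ent' 1 (chainC pr arcs s t U ent' a' a) (chainD pr arcs s t U ent' a' a) W))
    (hP0x : (∑ W ∈ U.powerset, prob pr (coreLevel arcs s U W) * chainMix ent ent' 0 (chainC pr arcs s t U ent' a' a) (chainD pr arcs s t U ent' a' a) W) *
        (∑ W ∈ U.powerset, prob pr (coreLevel arcs s U W) * chainMix ent ent' 0 (chainC pr arcs s t U ent' a' a) (chainD' pr arcs s t U ent' a' a w) W * (if m₁ ∈ W then (1 : R) else 0)) ≤
      (∑ W ∈ U.powerset, prob pr (coreLevel arcs s U W) * chainMix ent ent' 0 (chainC pr arcs s t U ent' a' a) (chainD pr arcs s t U ent' a' a) W * (if m₁ ∈ W then (1 : R) else 0)) *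
        (∑ W ∈ U.powerset, prob pr (coreLevel arcs s U W) * chainMix ent ent' 0 (chainC pr arcs s t U ent' a' a) (chainD' pr arcs s t U ent' a' a w) W))
    (hP'x : 0 ≤ ((∑ W ∈ U.powerset, prob pr (coreLevel arcs s U W) * chainMix ent ent' 0 (chainC pr arcs s t U ent' a' a) (chainD pr arcs s t U ent' a' a) W) *
          (∑ W ∈ U.powerset, prob pr (coreLevel arcs s U W) * chainMix ent ent' 1 (chainC pr arcs s t U ent' a' a) (chainD pr arcs s t U ent' a' a) W * (if m₁ ∈ W then (1 : R) else 0))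
        - (∑ W ∈ U.powerset, prob pr (coreLevel arcs s U W) * chainMix ent ent' 0 (chainC pr arcs s t U ent' a' a) (chainD pr arcs s t U ent' a' a) W * (if m₁ ∈ W then (1 : R) else 0)) *
          (∑ W ∈ U.powerset, prob pr (coreLevel arcs s U W) * chainMix ent ent' 1 (chainC pr arcs s t U ent' a' a) (chainD pr arcs s t U ent' a' a) W))
      - ((∑ W ∈ U.powerset, prob pr (coreLevel arcs s U W) * chainMix ent ent' 0 (chainC pr arcs s t U ent' a' a) (chainD pr arcs s t U ent' a' a) W) *
          (∑ W ∈ U.powerset, prob pr (coreLevel arcs s U W) * chainMix ent ent' 1 (chainC pr arcs s t U ent' a' a) (chainD' pr arcs s t U ent' a' a w) W * (if m₁ ∈ W then (1 : R) else 0))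
        - (∑ W ∈ U.powerset, prob pr (coreLevel arcs s U W) * chainMix ent ent' 0 (chainC pr arcs s t U ent' a' a) (chainD pr arcs s t U ent' a' a) W * (if m₁ ∈ W then (1 : R) else 0)) *
          (∑ W ∈ U.powerset, prob pr (coreLevel arcs s U W) * chainMix ent ent' 1 (chainC pr arcs s t U ent' a' a) (chainD' pr arcs s t U ent' a' a w) W))
      + ((∑ W ∈ U.powerset, prob pr (coreLevel arcs s U W) * chainMix ent ent' 0 (chainC pr arcs s t U ent' a' a) (chainD pr arcs s t U ent' a' a) W) *
          (∑ W ∈ U.powerset, prob pr (coreLevel arcs s U W) * chainMix ent ent' 0 (chainC pr arcs s t U ent' a' a) (chainD' pr arcs s t U ent' a' a w) W * (if m₁ ∈ W then (1 : R) else 0))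
        - (∑ W ∈ U.powerset, prob pr (coreLevel arcs s U W) * chainMix ent ent' 0 (chainC pr arcs s t U ent' a' a) (chainD pr arcs s t U ent' a' a) W * (if m₁ ∈ W then (1 : R) else 0)) *
          (∑ W ∈ U.powerset, prob pr (coreLevel arcs s U W) * chainMix ent ent' 0 (chainC pr arcs s t U ent' a' a) (chainD' pr arcs s t U ent' a' a w) W))) :
    DARC pr arcs s {t} m₁ m₂ a w := by
  obtain ⟨hA0, hAmono, hAlsm⟩ := OrTailU.head_props (U := insert a' U) (a := a) pr hp hS t
  obtain ⟨hdc, hd'd, hcc, hdd, hd'd', hdd', hratio, hratio', -, hcd, hcd'⟩ :=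
    chainPhi_head_hyps (fun X => prob pr (coreAvoidEvent arcs s t (insert a (insert a' U)) X))
      ent' a' a w hA0 hAmono hAlsm
  have hx0 : ∀ W : Finset V, (0 : R) ≤ (if m₁ ∈ W then (1 : R) else 0) := by
    intro W; split_ifs <;> norm_num
  have hy0 : ∀ W : Finset V, (0 : R) ≤ (if m₂ ∈ W then (1 : R) else 0) := by
    intro W; split_ifs <;> norm_num
  have hxm : ∀ s t : Finset V,
      (if m₁ ∈ s then (1 : R) else 0) ≤ (if m₁ ∈ s ∪ t then (1 : R) else 0) := by
    intro s t
    by_cases h : m₁ ∈ s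
    · rw [if_pos h, if_pos (Finset.mem_union_left t h)]
    · rw [if_neg h]; split_ifs <;> norm_num
  have hym : ∀ s t : Finset V,
      (if m₂ ∈ s then (1 : R) else 0) ≤ (if m₂ ∈ s ∪ t then (1 : R) else 0) := by
    intro s t
    by_cases h : m₂ ∈ s
    · rw [if_pos h, if_pos (Finset.mem_union_left t h)]
    · rw [if_neg h]; split_ifs <;> norm_num
  refine chain_darc_of_functional pr hS h' hsure' h hsure hentU hm₁ hm₂ htC hts hws hwC ?_
  exact chain_functional_nonneg_of_signs U ent ent' (fun W => prob pr (coreLevel arcs s U W))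
    (chainC pr arcs s t U ent' a' a) (chainD pr arcs s t U ent' a' a) (chainD' pr arcs s t U ent' a' a w)
    (pr (c a')) (hp.nonneg _) (hp.le_one _) (fun W => prob_nonneg hp _)
    (fun s' hs' t' ht' => hν s' t' hs' ht') (fun W => hA0 _) (fun W => hA0 _) (fun W => hA0 _)
    hdc (fun W => le_trans (hd'd W) (hdc W)) hd'd hcc hdd hd'd' hcd hcd' hdd' hratio hratio'
    (fun W => if m₁ ∈ W then (1 : R) else 0) (fun W => if m₂ ∈ W then (1 : R) else 0)
    hx0 hy0 hxm hym hpos0 hpos1 hmI hQx hP0x hP'x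

/-- **ROW 2′DARC AT THE GENERAL AND-SWITCH CHAIN UNDER THE THREE `y`-SIGN CONDITIONS** (the coin,
the world-0 gate and the `D′`-pivotal part all lower the `m₂`-mean; chain data
`ν = P(level)`, `c = chainC`, `d = chainD`, `d' = chainD'`, point markers `m₁, m₂ ∈ U`, an lsm
core, positive world masses and ideal mass): `DARC pr arcs s {t} m₁ m₂ a w`. -/
theorem darc_of_chain_of_signs_y (pr : E → R) (hp : IsProbVec pr) (hS : SameEnds arcs)
    (h' : OrTailK arcs s U ent' c' a') (hsure' : ∀ r ∈ ent', pr (c' r) = 1)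
    (h : OrTailK arcs s (insert a' U) (insert a' ent) c a) (hsure : ∀ r ∈ ent, pr (c r) = 1)
    (hentU : ent ⊆ U)
    {m₁ m₂ : V} (hm₁ : m₁ ∈ U) (hm₂ : m₂ ∈ U)
    (hν : ∀ W W', W ⊆ U → W' ⊆ U →
      prob pr (coreLevel arcs s U W) * prob pr (coreLevel arcs s U W') ≤
        prob pr (coreLevel arcs s U (W ∩ W')) * prob pr (coreLevel arcs s U (W ∪ W')))
    {t : V} (htC : t ∉ insert a (insert a' U)) (hts : t ≠ s) (hws : w ≠ s)
    (hwC : w ∉ insert a (insert a' U))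
    (hpos0 : 0 < ∑ W ∈ U.powerset, prob pr (coreLevel arcs s U W) *
      chainMix ent ent' 0 (chainC pr arcs s t U ent' a' a) (chainD pr arcs s t U ent' a' a) W)
    (hpos1 : 0 < ∑ W ∈ U.powerset, prob pr (coreLevel arcs s U W) *
      chainMix ent ent' 1 (chainC pr arcs s t U ent' a' a) (chainD pr arcs s t U ent' a' a) W)
    (hmI : 0 < ∑ W ∈ U.powerset.filter (fun W => ¬ ∃ r ∈ ent ∪ ent', r ∈ W),
      prob pr (coreLevel arcs s U W) * chainC pr arcs s t U ent' a' a W)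
    (hQy : (∑ W ∈ U.powerset, prob pr (coreLevel arcs s U W) * chainMix ent ent' 0 (chainC pr arcs s t U ent' a' a) (chainD pr arcs s t U ent' a' a) W) *
        (∑ W ∈ U.powerset, prob pr (coreLevel arcs s U W) * chainMix ent ent' 1 (chainC pr arcs s t U ent' a' a) (chainD pr arcs s t U ent' a' a) W * (if m₂ ∈ W then (1 : R) else 0)) ≤
      (∑ W ∈ U.powerset, prob pr (coreLevel arcs s U W) * chainMix ent ent' 0 (chainC pr arcs s t U ent' a' a) (chainD pr arcs s t U ent' a' a) W * (if m₂ ∈ W then (1 : R) else 0)) *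
        (∑ W ∈ U.powerset, prob pr (coreLevel arcs s U W) * chainMix ent ent' 1 (chainC pr arcs s t U ent' a' a) (chainD pr arcs s t U ent' a' a) W))
    (hP0y : (∑ W ∈ U.powerset, prob pr (coreLevel arcs s U W) * chainMix ent ent' 0 (chainC pr arcs s t U ent' a' a) (chainD pr arcs s t U ent' a' a) W) *
        (∑ W ∈ U.powerset, prob pr (coreLevel arcs s U W) * chainMix ent ent' 0 (chainC pr arcs s t U ent' a' a) (chainD' pr arcs s t U ent' a' a w) W * (if m₂ ∈ W then (1 : R) else 0)) ≤
      (∑ W ∈ U.powerset, prob pr (coreLevel arcs s U W) * chainMix ent ent' 0 (chainC pr arcs s t U ent' a' a) (chainD pr arcs s t U ent' a' a) W * (if m₂ ∈ W then (1 : R) else 0)) *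
        (∑ W ∈ U.powerset, prob pr (coreLevel arcs s U W) * chainMix ent ent' 0 (chainC pr arcs s t U ent' a' a) (chainD' pr arcs s t U ent' a' a w) W))
    (hP'y : 0 ≤ ((∑ W ∈ U.powerset, prob pr (coreLevel arcs s U W) * chainMix ent ent' 0 (chainC pr arcs s t U ent' a' a) (chainD pr arcs s t U ent' a' a) W) *
          (∑ W ∈ U.powerset, prob pr (coreLevel arcs s U W) * chainMix ent ent' 1 (chainC pr arcs s t U ent' a' a) (chainD pr arcs s t U ent' a' a) W * (if m₂ ∈ W then (1 : R) else 0))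
        - (∑ W ∈ U.powerset, prob pr (coreLevel arcs s U W) * chainMix ent ent' 0 (chainC pr arcs s t U ent' a' a) (chainD pr arcs s t U ent' a' a) W * (if m₂ ∈ W then (1 : R) else 0)) *
          (∑ W ∈ U.powerset, prob pr (coreLevel arcs s U W) * chainMix ent ent' 1 (chainC pr arcs s t U ent' a' a) (chainD pr arcs s t U ent' a' a) W))
      - ((∑ W ∈ U.powerset, prob pr (coreLevel arcs s U W) * chainMix ent ent' 0 (chainC pr arcs s t U ent' a' a) (chainD pr arcs s t U ent' a' a) W) *
          (∑ W ∈ U.powerset, prob pr (coreLevel arcs s U W) * chainMix ent ent' 1 (chainC pr arcs s t U ent' a' a) (chainD' pr arcs s t U ent' a' a w) W * (if m₂ ∈ W then (1 : R) else 0))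
        - (∑ W ∈ U.powerset, prob pr (coreLevel arcs s U W) * chainMix ent ent' 0 (chainC pr arcs s t U ent' a' a) (chainD pr arcs s t U ent' a' a) W * (if m₂ ∈ W then (1 : R) else 0)) *
          (∑ W ∈ U.powerset, prob pr (coreLevel arcs s U W) * chainMix ent ent' 1 (chainC pr arcs s t U ent' a' a) (chainD' pr arcs s t U ent' a' a w) W))
      + ((∑ W ∈ U.powerset, prob pr (coreLevel arcs s U W) * chainMix ent ent' 0 (chainC pr arcs s t U ent' a' a) (chainD pr arcs s t U ent' a' a) W) *
          (∑ W ∈ U.powerset, prob pr (coreLevel arcs s U W) * chainMix ent ent' 0 (chainC pr arcs s t U ent' a' a) (chainD' pr arcs s t U ent' a' a w) W * (if m₂ ∈ W then (1 : R) else 0))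
        - (∑ W ∈ U.powerset, prob pr (coreLevel arcs s U W) * chainMix ent ent' 0 (chainC pr arcs s t U ent' a' a) (chainD pr arcs s t U ent' a' a) W * (if m₂ ∈ W then (1 : R) else 0)) *
          (∑ W ∈ U.powerset, prob pr (coreLevel arcs s U W) * chainMix ent ent' 0 (chainC pr arcs s t U ent' a' a) (chainD' pr arcs s t U ent' a' a w) W))) :
    DARC pr arcs s {t} m₁ m₂ a w := by
  obtain ⟨hA0, hAmono, hAlsm⟩ := OrTailU.head_props (U := insert a' U) (a := a) pr hp hS t
  obtain ⟨hdc, hd'd, hcc, hdd, hd'd', hdd', hratio, hratio', -, hcd, hcd'⟩ :=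
    chainPhi_head_hyps (fun X => prob pr (coreAvoidEvent arcs s t (insert a (insert a' U)) X))
      ent' a' a w hA0 hAmono hAlsm
  have hx0 : ∀ W : Finset V, (0 : R) ≤ (if m₁ ∈ W then (1 : R) else 0) := by
    intro W; split_ifs <;> norm_num
  have hy0 : ∀ W : Finset V, (0 : R) ≤ (if m₂ ∈ W then (1 : R) else 0) := by
    intro W; split_ifs <;> norm_num
  have hxm : ∀ s t : Finset V,
      (if m₁ ∈ s then (1 : R) else 0) ≤ (if m₁ ∈ s ∪ t then (1 : R) else 0) := by
    intro s t
    by_cases h : m₁ ∈ s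
    · rw [if_pos h, if_pos (Finset.mem_union_left t h)]
    · rw [if_neg h]; split_ifs <;> norm_num
  have hym : ∀ s t : Finset V,
      (if m₂ ∈ s then (1 : R) else 0) ≤ (if m₂ ∈ s ∪ t then (1 : R) else 0) := by
    intro s t
    by_cases h : m₂ ∈ s
    · rw [if_pos h, if_pos (Finset.mem_union_left t h)]
    · rw [if_neg h]; split_ifs <;> norm_num
  refine chain_darc_of_functional pr hS h' hsure' h hsure hentU hm₁ hm₂ htC hts hws hwC ?_
  exact chain_functional_nonneg_of_signs_y U ent ent' (fun W => prob pr (coreLevel arcs s U W))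
    (chainC pr arcs s t U ent' a' a) (chainD pr arcs s t U ent' a' a) (chainD' pr arcs s t U ent' a' a w)
    (pr (c a')) (hp.nonneg _) (hp.le_one _) (fun W => prob_nonneg hp _)
    (fun s' hs' t' ht' => hν s' t' hs' ht') (fun W => hA0 _) (fun W => hA0 _) (fun W => hA0 _)
    hdc (fun W => le_trans (hd'd W) (hdc W)) hd'd hcc hdd hd'd' hcd hcd' hdd' hratio hratio'
    (fun W => if m₁ ∈ W then (1 : R) else 0) (fun W => if m₂ ∈ W then (1 : R) else 0)
    hx0 hy0 hxm hym hpos0 hpos1 hmI hQy hP0y hP'y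

/-- **ROW 2′DARC AT THE GENERAL AND-SWITCH CHAIN WHEN ALL SIX KILLED SHIFTS ARE NONPOSITIVE** (the
coin, the world-0 gate and the `D′`-pivotal part all raise both marker means; chain data
`ν = P(level)`, `c = chainC`, `d = chainD`, `d' = chainD'`, point markers `m₁, m₂ ∈ U`, an lsm
core, positive world masses and ideal mass): `DARC pr arcs s {t} m₁ m₂ a w`. -/
theorem darc_of_chain_of_negative_signs (pr : E → R) (hp : IsProbVec pr) (hS : SameEnds arcs)
    (h' : OrTailK arcs s U ent' c' a') (hsure' : ∀ r ∈ ent', pr (c' r) = 1)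
    (h : OrTailK arcs s (insert a' U) (insert a' ent) c a) (hsure : ∀ r ∈ ent, pr (c r) = 1)
    (hentU : ent ⊆ U)
    {m₁ m₂ : V} (hm₁ : m₁ ∈ U) (hm₂ : m₂ ∈ U)
    (hν : ∀ W W', W ⊆ U → W' ⊆ U →
      prob pr (coreLevel arcs s U W) * prob pr (coreLevel arcs s U W') ≤
        prob pr (coreLevel arcs s U (W ∩ W')) * prob pr (coreLevel arcs s U (W ∪ W')))
    {t : V} (htC : t ∉ insert a (insert a' U)) (hts : t ≠ s) (hws : w ≠ s)
    (hwC : w ∉ insert a (insert a' U))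
    (hpos0 : 0 < ∑ W ∈ U.powerset, prob pr (coreLevel arcs s U W) *
      chainMix ent ent' 0 (chainC pr arcs s t U ent' a' a) (chainD pr arcs s t U ent' a' a) W)
    (hpos1 : 0 < ∑ W ∈ U.powerset, prob pr (coreLevel arcs s U W) *
      chainMix ent ent' 1 (chainC pr arcs s t U ent' a' a) (chainD pr arcs s t U ent' a' a) W)
    (hmI : 0 < ∑ W ∈ U.powerset.filter (fun W => ¬ ∃ r ∈ ent ∪ ent', r ∈ W),
      prob pr (coreLevel arcs s U W) * chainC pr arcs s t U ent' a' a W)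
    (hQxn : (∑ W ∈ U.powerset, prob pr (coreLevel arcs s U W) * chainMix ent ent' 0 (chainC pr arcs s t U ent' a' a) (chainD pr arcs s t U ent' a' a) W * (if m₁ ∈ W then (1 : R) else 0)) *
        (∑ W ∈ U.powerset, prob pr (coreLevel arcs s U W) * chainMix ent ent' 1 (chainC pr arcs s t U ent' a' a) (chainD pr arcs s t U ent' a' a) W) ≤
      (∑ W ∈ U.powerset, prob pr (coreLevel arcs s U W) * chainMix ent ent' 0 (chainC pr arcs s t U ent' a' a) (chainD pr arcs s t U ent' a' a) W) *
        (∑ W ∈ U.powerset, prob pr (coreLevel arcs s U W) * chainMix ent ent' 1 (chainC pr arcs s t U ent' a' a) (chainD pr arcs s t U ent' a' a) W * (if m₁ ∈ W then (1 : R) else 0)))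
    (hP0xn : (∑ W ∈ U.powerset, prob pr (coreLevel arcs s U W) * chainMix ent ent' 0 (chainC pr arcs s t U ent' a' a) (chainD pr arcs s t U ent' a' a) W * (if m₁ ∈ W then (1 : R) else 0)) *
        (∑ W ∈ U.powerset, prob pr (coreLevel arcs s U W) * chainMix ent ent' 0 (chainC pr arcs s t U ent' a' a) (chainD' pr arcs s t U ent' a' a w) W) ≤
      (∑ W ∈ U.powerset, prob pr (coreLevel arcs s U W) * chainMix ent ent' 0 (chainC pr arcs s t U ent' a' a) (chainD pr arcs s t U ent' a' a) W) *
        (∑ W ∈ U.powerset, prob pr (coreLevel arcs s U W) * chainMix ent ent' 0 (chainC pr arcs s t U ent' a' a) (chainD' pr arcs s t U ent' a' a w) W * (if m₁ ∈ W then (1 : R) else 0)))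
    (hP'xn : ((∑ W ∈ U.powerset, prob pr (coreLevel arcs s U W) * chainMix ent ent' 0 (chainC pr arcs s t U ent' a' a) (chainD pr arcs s t U ent' a' a) W) *
          (∑ W ∈ U.powerset, prob pr (coreLevel arcs s U W) * chainMix ent ent' 1 (chainC pr arcs s t U ent' a' a) (chainD pr arcs s t U ent' a' a) W * (if m₁ ∈ W then (1 : R) else 0))
        - (∑ W ∈ U.powerset, prob pr (coreLevel arcs s U W) * chainMix ent ent' 0 (chainC pr arcs s t U ent' a' a) (chainD pr arcs s t U ent' a' a) W * (if m₁ ∈ W then (1 : R) else 0)) *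
          (∑ W ∈ U.powerset, prob pr (coreLevel arcs s U W) * chainMix ent ent' 1 (chainC pr arcs s t U ent' a' a) (chainD pr arcs s t U ent' a' a) W))
      - ((∑ W ∈ U.powerset, prob pr (coreLevel arcs s U W) * chainMix ent ent' 0 (chainC pr arcs s t U ent' a' a) (chainD pr arcs s t U ent' a' a) W) *
          (∑ W ∈ U.powerset, prob pr (coreLevel arcs s U W) * chainMix ent ent' 1 (chainC pr arcs s t U ent' a' a) (chainD' pr arcs s t U ent' a' a w) W * (if m₁ ∈ W then (1 : R) else 0))
        - (∑ W ∈ U.powerset, prob pr (coreLevel arcs s U W) * chainMix ent ent' 0 (chainC pr arcs s t U ent' a' a) (chainD pr arcs s t U ent' a' a) W * (if m₁ ∈ W then (1 : R) else 0)) *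
          (∑ W ∈ U.powerset, prob pr (coreLevel arcs s U W) * chainMix ent ent' 1 (chainC pr arcs s t U ent' a' a) (chainD' pr arcs s t U ent' a' a w) W))
      + ((∑ W ∈ U.powerset, prob pr (coreLevel arcs s U W) * chainMix ent ent' 0 (chainC pr arcs s t U ent' a' a) (chainD pr arcs s t U ent' a' a) W) *
          (∑ W ∈ U.powerset, prob pr (coreLevel arcs s U W) * chainMix ent ent' 0 (chainC pr arcs s t U ent' a' a) (chainD' pr arcs s t U ent' a' a w) W * (if m₁ ∈ W then (1 : R) else 0))
        - (∑ W ∈ U.powerset, prob pr (coreLevel arcs s U W) * chainMix ent ent' 0 (chainC pr arcs s t U ent' a' a) (chainD pr arcs s t U ent' a' a) W * (if m₁ ∈ W then (1 : R) else 0)) *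
          (∑ W ∈ U.powerset, prob pr (coreLevel arcs s U W) * chainMix ent ent' 0 (chainC pr arcs s t U ent' a' a) (chainD' pr arcs s t U ent' a' a w) W)) ≤ 0)
    (hQyn : (∑ W ∈ U.powerset, prob pr (coreLevel arcs s U W) * chainMix ent ent' 0 (chainC pr arcs s t U ent' a' a) (chainD pr arcs s t U ent' a' a) W * (if m₂ ∈ W then (1 : R) else 0)) *
        (∑ W ∈ U.powerset, prob pr (coreLevel arcs s U W) * chainMix ent ent' 1 (chainC pr arcs s t U ent' a' a) (chainD pr arcs s t U ent' a' a) W) ≤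
      (∑ W ∈ U.powerset, prob pr (coreLevel arcs s U W) * chainMix ent ent' 0 (chainC pr arcs s t U ent' a' a) (chainD pr arcs s t U ent' a' a) W) *
        (∑ W ∈ U.powerset, prob pr (coreLevel arcs s U W) * chainMix ent ent' 1 (chainC pr arcs s t U ent' a' a) (chainD pr arcs s t U ent' a' a) W * (if m₂ ∈ W then (1 : R) else 0)))
    (hP0yn : (∑ W ∈ U.powerset, prob pr (coreLevel arcs s U W) * chainMix ent ent' 0 (chainC pr arcs s t U ent' a' a) (chainD pr arcs s t U ent' a' a) W * (if m₂ ∈ W then (1 : R) else 0)) *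
        (∑ W ∈ U.powerset, prob pr (coreLevel arcs s U W) * chainMix ent ent' 0 (chainC pr arcs s t U ent' a' a) (chainD' pr arcs s t U ent' a' a w) W) ≤
      (∑ W ∈ U.powerset, prob pr (coreLevel arcs s U W) * chainMix ent ent' 0 (chainC pr arcs s t U ent' a' a) (chainD pr arcs s t U ent' a' a) W) *
        (∑ W ∈ U.powerset, prob pr (coreLevel arcs s U W) * chainMix ent ent' 0 (chainC pr arcs s t U ent' a' a) (chainD' pr arcs s t U ent' a' a w) W * (if m₂ ∈ W then (1 : R) else 0)))
    (hP'yn : ((∑ W ∈ U.powerset, prob pr (coreLevel arcs s U W) * chainMix ent ent' 0 (chainC pr arcs s t U ent' a' a) (chainD pr arcs s t U ent' a' a) W) *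
          (∑ W ∈ U.powerset, prob pr (coreLevel arcs s U W) * chainMix ent ent' 1 (chainC pr arcs s t U ent' a' a) (chainD pr arcs s t U ent' a' a) W * (if m₂ ∈ W then (1 : R) else 0))
        - (∑ W ∈ U.powerset, prob pr (coreLevel arcs s U W) * chainMix ent ent' 0 (chainC pr arcs s t U ent' a' a) (chainD pr arcs s t U ent' a' a) W * (if m₂ ∈ W then (1 : R) else 0)) *
          (∑ W ∈ U.powerset, prob pr (coreLevel arcs s U W) * chainMix ent ent' 1 (chainC pr arcs s t U ent' a' a) (chainD pr arcs s t U ent' a' a) W))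
      - ((∑ W ∈ U.powerset, prob pr (coreLevel arcs s U W) * chainMix ent ent' 0 (chainC pr arcs s t U ent' a' a) (chainD pr arcs s t U ent' a' a) W) *
          (∑ W ∈ U.powerset, prob pr (coreLevel arcs s U W) * chainMix ent ent' 1 (chainC pr arcs s t U ent' a' a) (chainD' pr arcs s t U ent' a' a w) W * (if m₂ ∈ W then (1 : R) else 0))
        - (∑ W ∈ U.powerset, prob pr (coreLevel arcs s U W) * chainMix ent ent' 0 (chainC pr arcs s t U ent' a' a) (chainD pr arcs s t U ent' a' a) W * (if m₂ ∈ W then (1 : R) else 0)) *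
          (∑ W ∈ U.powerset, prob pr (coreLevel arcs s U W) * chainMix ent ent' 1 (chainC pr arcs s t U ent' a' a) (chainD' pr arcs s t U ent' a' a w) W))
      + ((∑ W ∈ U.powerset, prob pr (coreLevel arcs s U W) * chainMix ent ent' 0 (chainC pr arcs s t U ent' a' a) (chainD pr arcs s t U ent' a' a) W) *
          (∑ W ∈ U.powerset, prob pr (coreLevel arcs s U W) * chainMix ent ent' 0 (chainC pr arcs s t U ent' a' a) (chainD' pr arcs s t U ent' a' a w) W * (if m₂ ∈ W then (1 : R) else 0))
        - (∑ W ∈ U.powerset, prob pr (coreLevel arcs s U W) * chainMix ent ent' 0 (chainC pr arcs s t U ent' a' a) (chainD pr arcs s t U ent' a' a) W * (if m₂ ∈ W then (1 : R) else 0)) *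
          (∑ W ∈ U.powerset, prob pr (coreLevel arcs s U W) * chainMix ent ent' 0 (chainC pr arcs s t U ent' a' a) (chainD' pr arcs s t U ent' a' a w) W)) ≤ 0) :
    DARC pr arcs s {t} m₁ m₂ a w := by
  obtain ⟨hA0, hAmono, hAlsm⟩ := OrTailU.head_props (U := insert a' U) (a := a) pr hp hS t
  obtain ⟨hdc, hd'd, hcc, hdd, hd'd', hdd', hratio, hratio', -, hcd, hcd'⟩ :=
    chainPhi_head_hyps (fun X => prob pr (coreAvoidEvent arcs s t (insert a (insert a' U)) X))
      ent' a' a w hA0 hAmono hAlsm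
  have hx0 : ∀ W : Finset V, (0 : R) ≤ (if m₁ ∈ W then (1 : R) else 0) := by
    intro W; split_ifs <;> norm_num
  have hy0 : ∀ W : Finset V, (0 : R) ≤ (if m₂ ∈ W then (1 : R) else 0) := by
    intro W; split_ifs <;> norm_num
  have hxm : ∀ s t : Finset V,
      (if m₁ ∈ s then (1 : R) else 0) ≤ (if m₁ ∈ s ∪ t then (1 : R) else 0) := by
    intro s t
    by_cases h : m₁ ∈ s
    · rw [if_pos h, if_pos (Finset.mem_union_left t h)]
    · rw [if_neg h]; split_ifs <;> norm_num
  have hym : ∀ s t : Finset V,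
      (if m₂ ∈ s then (1 : R) else 0) ≤ (if m₂ ∈ s ∪ t then (1 : R) else 0) := by
    intro s t
    by_cases h : m₂ ∈ s
    · rw [if_pos h, if_pos (Finset.mem_union_left t h)]
    · rw [if_neg h]; split_ifs <;> norm_num
  refine chain_darc_of_functional pr hS h' hsure' h hsure hentU hm₁ hm₂ htC hts hws hwC ?_
  exact chain_functional_nonneg_of_negative_signs U ent ent' (fun W => prob pr (coreLevel arcs s U W))
    (chainC pr arcs s t U ent' a' a) (chainD pr arcs s t U ent' a' a) (chainD' pr arcs s t U ent' a' a w)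
    (pr (c a')) (hp.nonneg _) (hp.le_one _) (fun W => prob_nonneg hp _)
    (fun s' hs' t' ht' => hν s' t' hs' ht') (fun W => hA0 _) (fun W => hA0 _) (fun W => hA0 _)
    hdc (fun W => le_trans (hd'd W) (hdc W)) hd'd hcc hdd hd'd' hcd hcd' hdd' hratio hratio'
    (fun W => if m₁ ∈ W then (1 : R) else 0) (fun W => if m₂ ∈ W then (1 : R) else 0)
    hx0 hy0 hxm hym hpos0 hpos1 hmI hQxn hP0xn hP'xn hQyn hP0yn hP'yn

end XASignsDarc

end Summit.Ventures.PercRepro2.Coin
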